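import Literature.NumberTheory.GaloisRepresentations.ResidualRepOfTraceCongruence
import Literature.NumberTheory.GaloisRepresentations.ChebotarevCosetCyclotomic
import HarnessLib

/-!
# Crux `AdjointLiftingGL3` (stmt-Langlands-16779), line `birth`, stub S6 (`stub_galoisSeed`):
# residual bookkeeping for the trace identification

Interface-independent lemmas of step (7e) of the Galois-seed stub (reduction modulo `𝔪` of the
identity `tr r_ι(Ad π_g ⊗ χ) = μ ε⁻¹ · (tr ρ_g² / det ρ_g − 1)`):

* `charpoly_eq_of_frobenius_of_isOpen_ker` — two homomorphisms `Γ_F → GL_n(R)` with OPEN kernels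
  (residual representations) whose characteristic polynomials agree at the arithmetic Frobenius
  elements above almost every place agree everywhere (Chebotarev, proved coset form
  `infinite_setOf_prime_absNorm_frobenius_mul_inv_mem` for `N = ker τ ∩ ker τ'`);
* `norm_adTrace_sub_lt_one_of_charpoly_eq` — if `ρ, ρ' : G → GL₂(ℚ̄_p)` have residual
  characteristic polynomials given by `τ, τ'` (`HasResidualCharpolys`) and
  `det(X − τ(g)) = det(X − c_g τ'(g))` for scalars `c_g ≠ 0` (a twist), then the adjoint traces
  `tr²/det − 1` of `ρ(g)` and `ρ'(g)` are congruent modulo `𝔪`: `‖· − ·‖ < 1`;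
* `norm_mul_sub_mul_lt_one` — the ultrametric product rule used to assemble the seed congruence.
-/

set_option linter.dupNamespace false -- `Summit.Langlands.Langlands` is the mandated namespace

noncomputable section

namespace Summit.Langlands.Langlands.Cruxes.AdjointLiftingGL3.Birth

open scoped MatrixGroups NumberField Polynomial
open NumberField IsDedekindDomain Field Filter Polynomial IsLocalRing
open Literature.NumberTheory.GaloisRepresentations

/-! ## Chebotarev for homomorphisms with open kernel -/

section OpenKernel

/-- **Characteristic polynomials of open-kernel representations are determined by almost all
Frobenius elements.**  Let `τ, τ' : Γ_F → GL_n(R)` be homomorphisms with open kernels (e.g.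
residual Galois representations) such that, for all but finitely many finite places `v` of the
number field `F`, `det(X − τ(Φ)) = det(X − τ'(Φ))` for every arithmetic Frobenius `Φ` above `v`.
Then `det(X − τ(g)) = det(X − τ'(g))` for every `g ∈ Γ_F`: the proved coset form of Chebotarev
(`infinite_setOf_prime_absNorm_frobenius_mul_inv_mem`) for the open normal subgroup
`N = ker τ ∩ ker τ'` gives a good place with a Frobenius `Φ ∈ N g`, where `τ(Φ) = τ(g)` and
`τ'(Φ) = τ'(g)`. [cite: TateGCFT1967, §2.4 (Tchebotarev density theorem, existence form)] -/
theorem charpoly_eq_of_frobenius_of_isOpen_ker :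
    ∀ {F : Type} [Field F] [NumberField F] {R : Type*} [CommRing R] {n : ℕ}
      (τ τ' : absoluteGaloisGroup F →* GL (Fin n) R),
      IsOpen (τ.ker : Set (absoluteGaloisGroup F)) → IsOpen (τ'.ker : Set (absoluteGaloisGroup F)) →
      (∀ᶠ v : HeightOneSpectrum (𝓞 F) in cofinite, ∀ 𝔓 ∈ v.primesAbove,
        ∀ Φ : absoluteGaloisGroup F, IsArithFrobAt (𝓞 F) Φ 𝔓 →
          ((τ Φ : GL (Fin n) R) : Matrix (Fin n) (Fin n) R).charpoly =
            ((τ' Φ : GL (Fin n) R) : Matrix (Fin n) (Fin n) R).charpoly) →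
      ∀ g : absoluteGaloisGroup F,
        ((τ g : GL (Fin n) R) : Matrix (Fin n) (Fin n) R).charpoly =
          ((τ' g : GL (Fin n) R) : Matrix (Fin n) (Fin n) R).charpoly := by
  intro F _ _ R _ n τ τ' hker hker' h g
  classical
  set N : Subgroup (absoluteGaloisGroup F) := τ.ker ⊓ τ'.ker with hNdef
  haveI : N.Normal := Subgroup.normal_inf_normal τ.ker τ'.ker
  have hN : IsOpen (N : Set (absoluteGaloisGroup F)) := by
    rw [hNdef, Subgroup.coe_inf]
    exact hker.inter hker'
  set S : Set (HeightOneSpectrum (𝓞 F)) := {v | ¬ ∀ 𝔓 ∈ v.primesAbove,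
      ∀ Φ : absoluteGaloisGroup F, IsArithFrobAt (𝓞 F) Φ 𝔓 →
        ((τ Φ : GL (Fin n) R) : Matrix (Fin n) (Fin n) R).charpoly =
          ((τ' Φ : GL (Fin n) R) : Matrix (Fin n) (Fin n) R).charpoly} with hSdef
  have hS : S.Finite := by
    rw [hSdef]
    exact Filter.eventually_cofinite.mp h
  have hC := infinite_setOf_prime_absNorm_frobenius_mul_inv_mem N hN g
  obtain ⟨v, ⟨-, -, 𝔓, h𝔓, Φ, hΦ, hΦg⟩, hvS⟩ := (hC.sdiff hS).nonempty
  have hv := not_not.mp hvS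
  have h1 : τ Φ = τ g := by
    have h1 : τ (Φ * g⁻¹) = 1 := (MonoidHom.mem_ker).mp hΦg.1
    rwa [map_mul, map_inv, mul_inv_eq_one] at h1
  have h2 : τ' Φ = τ' g := by
    have h2 : τ' (Φ * g⁻¹) = 1 := (MonoidHom.mem_ker).mp hΦg.2
    rwa [map_mul, map_inv, mul_inv_eq_one] at h2
  rw [← h1, ← h2]
  exact hv 𝔓 h𝔓 Φ hΦ

end OpenKernel

/-! ## The adjoint trace `tr²/det − 1` modulo `𝔪` -/

section AdTrace

variable {p : ℕ} [Fact p.Prime]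

/-- Coefficients of the characteristic polynomial of a `2 × 2` matrix: `coeff 0 = det`,
`coeff 1 = -tr` (Mathlib `Matrix.charpoly_fin_two`). [folklore] -/
theorem coeff_charpoly_fin_two {R : Type*} [CommRing R] [Nontrivial R] (M : Matrix (Fin 2) (Fin 2) R) :
    M.charpoly.coeff 0 = M.det ∧ M.charpoly.coeff 1 = -M.trace := by
  rw [Matrix.charpoly_fin_two]
  constructor
  · simp [coeff_X_pow, coeff_C, coeff_X]
  · simp [coeff_X_pow, coeff_C]

/-- **The adjoint trace of a `p`-adic representation is integral, with the residual adjoint trace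
as reduction.**  If `τ` carries the residual characteristic polynomials of
`ρ : G → GL₂(ℚ̄_p)` (`HasResidualCharpolys` over `ℤ̄_p`), then for every `g` there is
`A ∈ ℤ̄_p` with `A = tr ρ(g)² / det ρ(g) − 1` in `ℚ̄_p` and
`A mod 𝔪 = tr τ(g)² / det τ(g) − 1`. [folklore] -/
theorem exists_adTrace_integral {G : Type*} [Group G] {ρ : G →* GL (Fin 2) (PadicAlgCl p)}
    {τ : G →* GL (Fin 2) (padicAlgClResidueField p)}
    (h : HasResidualCharpolys (RingHom.id _) ρ τ) (g : G) :
    ∃ A : padicAlgClIntegers p,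
      (A : PadicAlgCl p) =
        ((ρ g : GL (Fin 2) (PadicAlgCl p)) : Matrix (Fin 2) (Fin 2) (PadicAlgCl p)).trace ^ 2 *
          (((ρ g : GL (Fin 2) (PadicAlgCl p)) : Matrix (Fin 2) (Fin 2) (PadicAlgCl p)).det)⁻¹ - 1 ∧
      residue (padicAlgClIntegers p) A =
        ((τ g : GL (Fin 2) (padicAlgClResidueField p)) :
            Matrix (Fin 2) (Fin 2) (padicAlgClResidueField p)).trace ^ 2 *
          (((τ g : GL (Fin 2) (padicAlgClResidueField p)) :
            Matrix (Fin 2) (Fin 2) (padicAlgClResidueField p)).det)⁻¹ - 1 := by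
  obtain ⟨P, hP, hP'⟩ := h g
  simp only [RingHom.id_comp] at hP'
  -- coefficients of `P`
  have hcK := coeff_charpoly_fin_two ((ρ g : GL (Fin 2) (PadicAlgCl p)) : Matrix (Fin 2) (Fin 2) (PadicAlgCl p))
  have hck := coeff_charpoly_fin_two ((τ g : GL (Fin 2) (padicAlgClResidueField p)) :
    Matrix (Fin 2) (Fin 2) (padicAlgClResidueField p))
  have hD : ((P.coeff 0 : padicAlgClIntegers p) : PadicAlgCl p) =
      ((ρ g : GL (Fin 2) (PadicAlgCl p)) : Matrix (Fin 2) (Fin 2) (PadicAlgCl p)).det := by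
    rw [← hcK.1, ← hP, coeff_map]; rfl
  have hT : ((P.coeff 1 : padicAlgClIntegers p) : PadicAlgCl p) =
      -((ρ g : GL (Fin 2) (PadicAlgCl p)) : Matrix (Fin 2) (Fin 2) (PadicAlgCl p)).trace := by
    rw [← hcK.2, ← hP, coeff_map]; rfl
  have hD' : residue (padicAlgClIntegers p) (P.coeff 0) =
      ((τ g : GL (Fin 2) (padicAlgClResidueField p)) :
        Matrix (Fin 2) (Fin 2) (padicAlgClResidueField p)).det := by
    rw [← hck.1, ← hP', coeff_map]
  have hT' : residue (padicAlgClIntegers p) (P.coeff 1) =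
      -((τ g : GL (Fin 2) (padicAlgClResidueField p)) :
        Matrix (Fin 2) (Fin 2) (padicAlgClResidueField p)).trace := by
    rw [← hck.2, ← hP', coeff_map]
  -- `P.coeff 0` is a unit of `ℤ̄_p`
  have hdet : ((τ g : GL (Fin 2) (padicAlgClResidueField p)) :
      Matrix (Fin 2) (Fin 2) (padicAlgClResidueField p)).det ≠ 0 :=
    (Matrix.isUnits_det_units (τ g)).ne_zero
  have hunit : IsUnit (P.coeff 0) := by
    by_contra hnu
    have hmem : P.coeff 0 ∈ maximalIdeal (padicAlgClIntegers p) :=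
      (IsLocalRing.mem_maximalIdeal _).mpr hnu
    rw [← residue_eq_zero_iff, hD'] at hmem
    exact hdet hmem
  set u : (padicAlgClIntegers p)ˣ := hunit.unit with hu
  have huval : (u : padicAlgClIntegers p) = P.coeff 0 := hunit.unit_spec
  refine ⟨(P.coeff 1) ^ 2 * ((u⁻¹ : (padicAlgClIntegers p)ˣ) : padicAlgClIntegers p) - 1, ?_, ?_⟩
  · have h1 : (((u⁻¹ : (padicAlgClIntegers p)ˣ) : padicAlgClIntegers p) : PadicAlgCl p) =
        (((u : padicAlgClIntegers p) : PadicAlgCl p))⁻¹ :=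
      map_units_inv (padicAlgClIntegers p).subtype u
    push_cast
    rw [h1, huval, hD, hT, neg_sq]
  · have h1 : residue (padicAlgClIntegers p) ((u⁻¹ : (padicAlgClIntegers p)ˣ) : padicAlgClIntegers p) =
        (residue (padicAlgClIntegers p) (u : padicAlgClIntegers p))⁻¹ :=
      map_units_inv (residue (padicAlgClIntegers p)) u
    rw [map_sub, map_one, map_mul, map_pow, h1, huval, hD', hT', neg_sq]

/-- **Two elements of `ℤ̄_p` with the same residue are at distance `< 1`** (converse of
`residue_eq_of_norm_sub_lt_one`). [folklore] -/
theorem norm_sub_lt_one_of_residue_eq {x y : padicAlgClIntegers p}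
    (h : residue (padicAlgClIntegers p) x = residue (padicAlgClIntegers p) y) :
    ‖(x : PadicAlgCl p) - y‖ < 1 := by
  rw [← sub_eq_zero, ← map_sub, residue_eq_zero_iff,
    mem_maximalIdeal_iff_norm_lt_one (padicAlgCl_mem_valuationSubring_iff p)] at h
  exact h

/-- **Twist-invariance of the adjoint trace modulo `𝔪`.**  Let `ρ, ρ' : G → GL₂(ℚ̄_p)` have
residual characteristic polynomials carried by `τ, τ' : G → GL₂(ℤ̄_p/𝔪)` (`HasResidualCharpolys`,
e.g. residual representations), and suppose `det(X − τ(g)) = det(X − c_g · τ'(g))` for scalars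
`c_g ≠ 0` (i.e. `τ ≅ c ⊗ τ'` on characteristic polynomials).  Then the adjoint traces
`tr²/det − 1` (the trace of `ad⁰`, invariant under twisting) of `ρ(g)` and `ρ'(g)` are congruent
modulo `𝔪`: `‖(tr ρ(g)²/det ρ(g) − 1) − (tr ρ'(g)²/det ρ'(g) − 1)‖ < 1`. [folklore] -/
theorem norm_adTrace_sub_lt_one_of_charpoly_eq :
    ∀ {p : ℕ} [Fact p.Prime] {G : Type*} [Group G]
      (ρ ρ' : G →* GL (Fin 2) (PadicAlgCl p))
      (τ τ' : G →* GL (Fin 2) (padicAlgClResidueField p)) (c : G → padicAlgClResidueField p),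
      HasResidualCharpolys (RingHom.id _) ρ τ → HasResidualCharpolys (RingHom.id _) ρ' τ' →
      (∀ g, c g ≠ 0) →
      (∀ g, ((τ g : GL (Fin 2) (padicAlgClResidueField p)) :
          Matrix (Fin 2) (Fin 2) (padicAlgClResidueField p)).charpoly =
        (c g • ((τ' g : GL (Fin 2) (padicAlgClResidueField p)) :
          Matrix (Fin 2) (Fin 2) (padicAlgClResidueField p))).charpoly) →
      ∀ g, ‖(((ρ g : GL (Fin 2) (PadicAlgCl p)) : Matrix (Fin 2) (Fin 2) (PadicAlgCl p)).trace ^ 2 *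
            (((ρ g : GL (Fin 2) (PadicAlgCl p)) : Matrix (Fin 2) (Fin 2) (PadicAlgCl p)).det)⁻¹ - 1) -
          (((ρ' g : GL (Fin 2) (PadicAlgCl p)) : Matrix (Fin 2) (Fin 2) (PadicAlgCl p)).trace ^ 2 *
            (((ρ' g : GL (Fin 2) (PadicAlgCl p)) : Matrix (Fin 2) (Fin 2) (PadicAlgCl p)).det)⁻¹ - 1)‖
        < 1 := by
  intro p _ G _ ρ ρ' τ τ' c hρ hρ' hc h g
  obtain ⟨A, hA, hAres⟩ := exists_adTrace_integral hρ g
  obtain ⟨A', hA', hA'res⟩ := exists_adTrace_integral hρ' g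
  rw [← hA, ← hA']
  refine norm_sub_lt_one_of_residue_eq ?_
  rw [hAres, hA'res]
  -- `tr τ = c tr τ'`, `det τ = c² det τ'`
  have hck := coeff_charpoly_fin_two ((τ g : GL (Fin 2) (padicAlgClResidueField p)) :
    Matrix (Fin 2) (Fin 2) (padicAlgClResidueField p))
  have hck' := coeff_charpoly_fin_two (c g • ((τ' g : GL (Fin 2) (padicAlgClResidueField p)) :
    Matrix (Fin 2) (Fin 2) (padicAlgClResidueField p)))
  have htr : ((τ g : GL (Fin 2) (padicAlgClResidueField p)) :
      Matrix (Fin 2) (Fin 2) (padicAlgClResidueField p)).trace =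
        c g * ((τ' g : GL (Fin 2) (padicAlgClResidueField p)) :
          Matrix (Fin 2) (Fin 2) (padicAlgClResidueField p)).trace := by
    have e := hck.2
    rw [h g, hck'.2, Matrix.trace_smul, smul_eq_mul, neg_inj] at e
    exact e.symm
  have hdet : ((τ g : GL (Fin 2) (padicAlgClResidueField p)) :
      Matrix (Fin 2) (Fin 2) (padicAlgClResidueField p)).det =
        c g ^ 2 * ((τ' g : GL (Fin 2) (padicAlgClResidueField p)) :
          Matrix (Fin 2) (Fin 2) (padicAlgClResidueField p)).det := by
    have e := hck.1
    rw [h g, hck'.1, Matrix.det_smul, Fintype.card_fin] at e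
    exact e.symm
  have hdet' : ((τ' g : GL (Fin 2) (padicAlgClResidueField p)) :
      Matrix (Fin 2) (Fin 2) (padicAlgClResidueField p)).det ≠ 0 :=
    (Matrix.isUnits_det_units (τ' g)).ne_zero
  rw [htr, hdet]
  have hcg := hc g
  field_simp

end AdTrace

/-! ## Ultrametric assembly -/

section Ultrametric

/-- **Ultrametric product rule in `ℚ̄_p`**: if `‖x‖ ≤ 1`, `‖y'‖ ≤ 1`, `‖x − x'‖ < 1` and
`‖y − y'‖ < 1` then `‖x y − x' y'‖ < 1` (`x y − x' y' = x (y − y') + (x − x') y'` and the norm of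
`ℚ̄_p` is non-archimedean, `PadicAlgCl.isUltrametricDist`). [folklore] -/
theorem norm_mul_sub_mul_lt_one :
    ∀ {p : ℕ} [Fact p.Prime] (x x' y y' : PadicAlgCl p),
      ‖x‖ ≤ 1 → ‖y'‖ ≤ 1 → ‖x - x'‖ < 1 → ‖y - y'‖ < 1 → ‖x * y - x' * y'‖ < 1 := by
  intro p _ x x' y y' hx hy' hxx' hyy'
  have e : x * y - x' * y' = x * (y - y') + (x - x') * y' := by ring
  rw [e]
  refine lt_of_le_of_lt (IsUltrametricDist.norm_add_le_max _ _) (max_lt ?_ ?_)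
  · rw [norm_mul]
    calc ‖x‖ * ‖y - y'‖ ≤ 1 * ‖y - y'‖ := by gcongr
      _ < 1 := by rw [one_mul]; exact hyy'
  · rw [norm_mul]
    calc ‖x - x'‖ * ‖y'‖ ≤ ‖x - x'‖ * 1 := by gcongr
      _ < 1 := by rw [mul_one]; exact hxx'

end Ultrametric

end Summit.Langlands.Langlands.Cruxes.AdjointLiftingGL3.Birth

end
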